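import Summits.ResolutionOfSingularities.ResolutionOfSingularities.Theorems.HomologicalConductorNoZenoBirthDefs
import Summits.ResolutionOfSingularities.ResolutionOfSingularities.Theorems.SyzygyFlatteningHigherRankTerminationTowerStageBasic
import Summits.ResolutionOfSingularities.ResolutionOfSingularities.Theorems.SyzygyFlatteningHigherRankTerminationLocAt
import Summits.ResolutionOfSingularities.ResolutionOfSingularities.Theorems.SyzygyFlatteningHigherRankTerminationEssFiniteType
import Literature.RingTheory.CohomologyAnnihilator.Basic
import Literature.AlgebraicGeometry.Resolution.IntegralClosureEssFiniteType
import HarnessLib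

/-!
# Crux `NoZeno` (stmt-ResolutionOfSingularities-16483), line `birth` — stub `stub_towerNoetherian`

Route `ResolutionOfSingularities/HomologicalConductor`, crux
`Summit.ResolutionOfSingularities.ResolutionOfSingularities.Theses.HomologicalConductor.NoZeno`.
Registered stub 2 of the line `birth` (v2): every stage `T_m = tower O A m` of the canonical
normalised `ca`-tower of a finitely generated `A ⊆ O` with `Frac A = K` is a noetherian ring.

Proof: by induction every stage is ESSENTIALLY OF FINITE TYPE over `k`, contains `A` (hence has
fraction field `K`) and lies in `O`:
* `loc O B` (= `SyzygyFlattening.locAt O B`, `loc_eq_locAt`) is a localisation of `B`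
  (tree `SyzygyFlattening.stub_essFiniteType_locAt`);
* `chart O B = k[B ∪ {c * x⁻¹ | c ∈ ca B, x admissible}]` is a localisation of the finitely
  generated `B`-algebra `B[c₁/x₀, …, c_r/x₀]`: `ca B` is the image of the ideal
  `cohomologyAnnihilator ↥B` (`Subalgebra.image_coe_cohomologyAnnihilator`), finitely generated as
  `B` is noetherian; all admissible `x` have the same value, `x/x₀` and `x₀/x` are both adjoined,
  and `c/x = (Σ bᵢ cᵢ)/x₀ · (x₀/x)`;
* `nrm C` (= `SyzygyFlattening.nrm C`) is module-finite over `C` when `Frac C = K`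
  (tree `SyzygyFlattening.stub_essFiniteType_nrm`, E. Noether);
and essentially-finite-type algebras over a field are noetherian
(`Algebra.EssFiniteType.isNoetherianRing`).
-/

noncomputable section

-- single-problem summit: the doubled namespace component `ResolutionOfSingularities` is forced
set_option linter.dupNamespace false

namespace Summit.ResolutionOfSingularities.ResolutionOfSingularities.Theorems.NoZeno.Birth

open Summit.ResolutionOfSingularities.ResolutionOfSingularities.Theses.HomologicalConductor

open Literature.AlgebraicGeometry.Resolution Literature.RingTheory.CohomologyAnnihilator

variable {k K : Type} [Field k] [Field K] [Algebra k K]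

/-! ## Localisation inside `K` preserves essential finiteness -/

/-- **Localisation lemma.** If `C ≤ D` are `k`-subalgebras of `K`, `C` is essentially of finite
type over `k`, and every element of `D` is a fraction `c * u⁻¹` with `c, u ∈ C`, `u ≠ 0` and
`u⁻¹ ∈ D`, then `D` is the localisation of `C` at the elements of `C` invertible in `D`, hence
essentially of finite type over `k` (pattern of `SyzygyFlattening.stub_essFiniteType_locAt`).
[folklore] -/
theorem tn_essFiniteType_of_frac {C D : Subalgebra k K} (hCD : C ≤ D)
    (hC : Algebra.EssFiniteType k ↥C)
    (hfrac : ∀ d ∈ D, ∃ c ∈ C, ∃ u ∈ C, u ≠ 0 ∧ u⁻¹ ∈ D ∧ d = c * u⁻¹) :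
    Algebra.EssFiniteType k ↥D := by
  -- adapted from `SyzygyFlattening.stub_essFiniteType_locAt`
  haveI := hC
  letI : Algebra ↥C ↥D := (Subalgebra.inclusion hCD).toRingHom.toAlgebra
  haveI : IsScalarTower k ↥C ↥D := IsScalarTower.of_algebraMap_eq fun _ => rfl
  haveI : IsLocalization ((IsUnit.submonoid ↥D).comap (algebraMap ↥C ↥D)) ↥D := by
    refine (isLocalization_iff _ _).mpr ⟨fun s => s.2, fun y => ?_, fun {a b} hab => ?_⟩
    · obtain ⟨c, hc, u, hu, hu0, huD, hy⟩ := hfrac y y.2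
      have hunit : IsUnit (algebraMap ↥C ↥D ⟨u, hu⟩) := by
        refine IsUnit.of_mul_eq_one ⟨u⁻¹, huD⟩ (Subtype.ext ?_)
        exact mul_inv_cancel₀ hu0
      refine ⟨(⟨c, hc⟩, ⟨⟨u, hu⟩, hunit⟩), Subtype.ext ?_⟩
      change (y : K) * u = c
      rw [hy, inv_mul_cancel_right₀ hu0]
    · have hab' : (a : K) = b := congrArg (fun t : ↥D => (t : K)) hab
      exact ⟨1, by rw [Subtype.ext hab']⟩
  haveI : Algebra.EssFiniteType ↥C ↥D :=
    Algebra.EssFiniteType.of_isLocalization ↥D ((IsUnit.submonoid ↥D).comap (algebraMap ↥C ↥D))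
  exact Algebra.EssFiniteType.comp k ↥C ↥D

/-- `k[B ∪ F]` is essentially of finite type over `k` when `B` is and `F` is finite: it is
`B[F]` with scalars restricted to `k` (`Algebra.restrictScalars_adjoin`, tree lemma
`essFiniteType_adjoin`). [folklore] -/
theorem tn_essFiniteType_adjoin_union (B : Subalgebra k K) (hB : Algebra.EssFiniteType k ↥B)
    (F : Finset K) : Algebra.EssFiniteType k ↥(Algebra.adjoin k ((B : Set K) ∪ ↑F)) := by
  haveI := hB
  rw [← Algebra.restrictScalars_adjoin]
  exact essFiniteType_adjoin F

/-! ## The chart `chart O B` is a localisation of a finitely generated `B`-algebra -/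

/-- `ca B` is the image of the ideal `cohomologyAnnihilator ↥B`: for `g ∈ B`,
`(g : K) ∈ ca B ↔ g ∈ ca(↥B)`. [cite: IyengarTakahashi2014, Definition 2.1] -/
theorem tn_coe_mem_ca_iff (B : Subalgebra k K) (g : ↥B) :
    (g : K) ∈ ca B ↔ g ∈ cohomologyAnnihilator ↥B := by
  rw [mem_ca_iff, mem_cohomologyAnnihilator_iff']
  exact ⟨fun ⟨_, h⟩ => h, fun h => ⟨g.2, h⟩⟩

/-- **Common denominator for the chart generators.** If `B` is noetherian there is a finite set
`F` of chart generators such that every chart generator `c * x⁻¹` (`c, x ∈ ca B`, `x ≠ 0` of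
minimal value) is a fraction `c₁ * u⁻¹` with `c₁, u ∈ k[B ∪ F]`, `u ≠ 0`, `u⁻¹ ∈ chart O B`.
Indeed `ca B` is the image of the finitely generated ideal `ca(↥B) = (g₁, …, g_r)`; with one
admissible denominator `x₀` fixed, `F = {gᵢ * x₀⁻¹}`, every `z ∈ ca B` has `z * x₀⁻¹ ∈ k[B ∪ F]`,
`c * x⁻¹ = (c * x₀⁻¹) * (x * x₀⁻¹)⁻¹`, and `(x * x₀⁻¹)⁻¹ = x₀ * x⁻¹` is itself a chart generator
(no admissible `x₀`: `F = ∅`). [folklore] -/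
theorem tn_exists_finset_chartGen (O : ValuationSubring K) (B : Subalgebra k K)
    [IsNoetherianRing ↥B] :
    ∃ F : Finset K,
      (↑F : Set K) ⊆ {y : K | ∃ c ∈ ca B, ∃ x ∈ ca B, x ≠ 0 ∧
        (∀ c' ∈ ca B, c' * x⁻¹ ∈ O) ∧ y = c * x⁻¹} ∧
      ∀ y ∈ {y : K | ∃ c ∈ ca B, ∃ x ∈ ca B, x ≠ 0 ∧ (∀ c' ∈ ca B, c' * x⁻¹ ∈ O) ∧ y = c * x⁻¹},
        ∃ c ∈ Algebra.adjoin k ((B : Set K) ∪ ↑F), ∃ u ∈ Algebra.adjoin k ((B : Set K) ∪ ↑F),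
          u ≠ 0 ∧ u⁻¹ ∈ chart O B ∧ y = c * u⁻¹ := by
  classical
  by_cases hx₀ : ∃ x₀ ∈ ca B, x₀ ≠ 0 ∧ ∀ c' ∈ ca B, c' * x₀⁻¹ ∈ O
  · obtain ⟨x₀, hx₀ca, hx₀0, hmin₀⟩ := hx₀
    -- the cohomology annihilator ideal of the noetherian ring `B` is finitely generated
    obtain ⟨G, hG⟩ := IsNoetherian.noetherian (cohomologyAnnihilator ↥B)
    set F : Finset K := G.image fun g : ↥B => (g : K) * x₀⁻¹ with hF
    set C : Subalgebra k K := Algebra.adjoin k ((B : Set K) ∪ ↑F) with hC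
    -- every element of `ca B`, divided by `x₀`, lies in `k[B ∪ F]`
    have key : ∀ z ∈ ca B, z * x₀⁻¹ ∈ C := by
      intro z hz
      obtain ⟨hzB, n, hn⟩ := hz
      have hzI : (⟨z, hzB⟩ : ↥B) ∈ Submodule.span ↥B (↑G : Set ↥B) := by
        rw [hG]
        exact mem_cohomologyAnnihilator_iff'.mpr ⟨n, hn⟩
      suffices h : ∀ v ∈ Submodule.span ↥B (↑G : Set ↥B), (v : K) * x₀⁻¹ ∈ C from h _ hzI
      intro v hv
      induction hv using Submodule.span_induction with
      | mem w hw =>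
        refine Algebra.subset_adjoin (Or.inr ?_)
        rw [hF, Finset.coe_image]
        exact Set.mem_image_of_mem _ hw
      | zero =>
        rw [ZeroMemClass.coe_zero, zero_mul]
        exact C.zero_mem
      | add a b _ _ ha hb =>
        rw [AddMemClass.coe_add, add_mul]
        exact C.add_mem ha hb
      | smul r a _ ha =>
        rw [smul_eq_mul, MulMemClass.coe_mul, mul_assoc]
        exact C.mul_mem (Algebra.subset_adjoin (Or.inl r.2)) ha
    refine ⟨F, ?_, ?_⟩
    · intro y hy
      rw [hF, Finset.coe_image] at hy
      obtain ⟨g, hg, rfl⟩ := hy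
      have hgI : g ∈ cohomologyAnnihilator ↥B := by
        rw [← hG]
        exact Submodule.subset_span hg
      exact ⟨g, (tn_coe_mem_ca_iff B g).mpr hgI, x₀, hx₀ca, hx₀0, hmin₀, rfl⟩
    · rintro y ⟨c, hc, x, hx, hx0, hmin, rfl⟩
      refine ⟨c * x₀⁻¹, key c hc, x * x₀⁻¹, key x hx, mul_ne_zero hx0 (inv_ne_zero hx₀0),
        ?_, ?_⟩
      · rw [mul_inv, inv_inv, mul_comm]
        exact Algebra.subset_adjoin (Or.inr ⟨x₀, hx₀ca, x, hx, hx0, hmin, rfl⟩)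
      · rw [mul_inv, inv_inv, mul_assoc, mul_left_comm x₀⁻¹, inv_mul_cancel₀ hx₀0, mul_one]
  · refine ⟨∅, by simp, ?_⟩
    rintro y ⟨c, -, x, hx, hx0, hmin, rfl⟩
    exact absurd ⟨x, hx, hx0, hmin⟩ hx₀

/-- **Every element of the chart is a fraction** over `k[B ∪ F]` with denominator inverted in
the chart, for any finite `F` as in `tn_exists_finset_chartGen` (induction over
`Algebra.adjoin`, taking common denominators). [folklore] -/
theorem tn_chart_frac (O : ValuationSubring K) (B : Subalgebra k K) {F : Finset K}
    (hF : ∀ y ∈ {y : K | ∃ c ∈ ca B, ∃ x ∈ ca B, x ≠ 0 ∧ (∀ c' ∈ ca B, c' * x⁻¹ ∈ O) ∧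
        y = c * x⁻¹},
      ∃ c ∈ Algebra.adjoin k ((B : Set K) ∪ ↑F), ∃ u ∈ Algebra.adjoin k ((B : Set K) ∪ ↑F),
        u ≠ 0 ∧ u⁻¹ ∈ chart O B ∧ y = c * u⁻¹)
    {d : K} (hd : d ∈ chart O B) :
    ∃ c ∈ Algebra.adjoin k ((B : Set K) ∪ ↑F), ∃ u ∈ Algebra.adjoin k ((B : Set K) ∪ ↑F),
      u ≠ 0 ∧ u⁻¹ ∈ chart O B ∧ d = c * u⁻¹ := by
  set C : Subalgebra k K := Algebra.adjoin k ((B : Set K) ∪ ↑F) with hC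
  have hBC : B ≤ C := fun b hb => Algebra.subset_adjoin (Or.inl hb)
  -- elements of `C` are fractions with denominator `1`
  have hone : ∀ z ∈ C, ∃ c ∈ C, ∃ u ∈ C, u ≠ 0 ∧ u⁻¹ ∈ chart O B ∧ z = c * u⁻¹ :=
    fun z hz => ⟨z, hz, 1, C.one_mem, one_ne_zero, by rw [inv_one]; exact (chart O B).one_mem,
      by rw [inv_one, mul_one]⟩
  unfold chart at hd
  induction hd using Algebra.adjoin_induction with
  | mem y hy =>
    rcases hy with hy | hy
    · exact hone y (hBC hy)
    · exact hF y hy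
  | algebraMap r => exact hone _ (C.algebraMap_mem r)
  | add y z _ _ hy hz =>
    obtain ⟨c₁, hc₁, u₁, hu₁, hu₁0, hu₁i, rfl⟩ := hy
    obtain ⟨c₂, hc₂, u₂, hu₂, hu₂0, hu₂i, rfl⟩ := hz
    refine ⟨c₁ * u₂ + u₁ * c₂, C.add_mem (C.mul_mem hc₁ hu₂) (C.mul_mem hu₁ hc₂), u₁ * u₂,
      C.mul_mem hu₁ hu₂, mul_ne_zero hu₁0 hu₂0, ?_, ?_⟩
    · rw [mul_inv]
      exact (chart O B).mul_mem hu₁i hu₂i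
    · rw [← div_eq_mul_inv, ← div_eq_mul_inv, ← div_eq_mul_inv, div_add_div _ _ hu₁0 hu₂0]
  | mul y z _ _ hy hz =>
    obtain ⟨c₁, hc₁, u₁, hu₁, hu₁0, hu₁i, rfl⟩ := hy
    obtain ⟨c₂, hc₂, u₂, hu₂, hu₂0, hu₂i, rfl⟩ := hz
    refine ⟨c₁ * c₂, C.mul_mem hc₁ hc₂, u₁ * u₂, C.mul_mem hu₁ hu₂, mul_ne_zero hu₁0 hu₂0,
      ?_, ?_⟩
    · rw [mul_inv]
      exact (chart O B).mul_mem hu₁i hu₂i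
    · rw [mul_inv]
      ring

/-- **The chart stays essentially of finite type.** For `B` essentially of finite type over
`k` (hence noetherian), `chart O B` is a localisation of `k[B ∪ F]` for a finite set `F` of
chart generators (`tn_exists_finset_chartGen`, `tn_chart_frac`, `tn_essFiniteType_of_frac`),
hence essentially of finite type over `k`. [folklore] -/
theorem tn_essFiniteType_chart (O : ValuationSubring K) (B : Subalgebra k K)
    (hB : Algebra.EssFiniteType k ↥B) : Algebra.EssFiniteType k ↥(chart O B) := by
  haveI := hB
  haveI : IsNoetherianRing ↥B := Algebra.EssFiniteType.isNoetherianRing k ↥B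
  obtain ⟨F, hFsub, hF⟩ := tn_exists_finset_chartGen O B
  exact tn_essFiniteType_of_frac (Algebra.adjoin_mono (Set.union_subset_union_right _ hFsub))
    (tn_essFiniteType_adjoin_union B hB F) fun d hd => tn_chart_frac O B hF hd

/-! ## The invariant of the tower and the registered stub -/

/-- **The invariant of the tower.** Every stage `T_m` contains `A`, lies in `O`, and is
essentially of finite type over `k`: `loc O ·` is a localisation
(`SyzygyFlattening.stub_essFiniteType_locAt`, via `loc_eq_locAt`), `chart O ·` is a
localisation of a finitely generated extension (`tn_essFiniteType_chart`), and `nrm ·` is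
module-finite when the fraction field is `K` (`SyzygyFlattening.stub_essFiniteType_nrm`, via
`nrm_eq_nrm`; `Frac = K` because `A ≤ T_m`). [cite: Liu2002, Prop. 4.1.27] -/
theorem tn_tower_invariant (O : ValuationSubring K) (A : Subalgebra k K)
    (hk : ∀ c : k, algebraMap k K c ∈ O) (hA : A.FG) (hfr : IsFractionRing ↥A K)
    (hAO : A.toSubring ≤ O.toSubring) (m : ℕ) :
    A ≤ tower O A m ∧ (tower O A m).toSubring ≤ O.toSubring ∧
      Algebra.EssFiniteType k ↥(tower O A m) := by
  haveI := hfr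
  induction m with
  | zero =>
    haveI : Algebra.FiniteType k ↥A := (Subalgebra.fg_iff_finiteType A).mp hA
    have hE : Algebra.EssFiniteType k ↥A := inferInstance
    rw [tower_zero, loc_eq_locAt]
    exact ⟨SyzygyFlattening.self_le_locAt O A, SyzygyFlattening.locAt_toSubring_le O hk hAO,
      SyzygyFlattening.stub_essFiniteType_locAt k K O A hAO hfr hE⟩
  | succ m ih =>
    obtain ⟨hAT, hTO, hET⟩ := ih
    rw [tower_succ, loc_eq_locAt, nrm_eq_nrm]
    -- the chart contains `T_m`, and lies in `O`: a generator `c * x⁻¹` (`c ∈ ca T_m`, `x` of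
    -- minimal value) is in `O` by the minimality of `x` applied to `c' := c`
    have hTc : tower O A m ≤ chart O (tower O A m) := fun _ hb => Algebra.subset_adjoin (Or.inl hb)
    have hAc : A ≤ chart O (tower O A m) := hAT.trans hTc
    have hcO : (chart O (tower O A m)).toSubring ≤ O.toSubring := by
      refine SyzygyFlattening.adjoin_toSubring_le_valuationSubring O hk ?_
      rintro y (hy | ⟨c, hc, x, -, -, hmin, rfl⟩)
      · exact hTO (Subalgebra.mem_toSubring.mpr hy)
      · exact hmin c hc
    have hEc : Algebra.EssFiniteType k ↥(chart O (tower O A m)) :=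
      tn_essFiniteType_chart O _ hET
    -- the normalisation
    have hAn : A ≤ SyzygyFlattening.nrm (chart O (tower O A m)) :=
      hAc.trans (SyzygyFlattening.self_le_nrm _)
    have hnO : (SyzygyFlattening.nrm (chart O (tower O A m))).toSubring ≤ O.toSubring :=
      SyzygyFlattening.nrm_toSubring_le O hk hcO
    have hEn : Algebra.EssFiniteType k ↥(SyzygyFlattening.nrm (chart O (tower O A m))) :=
      SyzygyFlattening.stub_essFiniteType_nrm k K _ (isFractionRing_subalgebra_of_le A _ hAc) hEc
    -- the localisation at the centre
    exact ⟨hAn.trans (SyzygyFlattening.self_le_locAt O _),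
      SyzygyFlattening.locAt_toSubring_le O hk hnO,
      SyzygyFlattening.stub_essFiniteType_locAt k K O _ hnO
        (isFractionRing_subalgebra_of_le A _ hAn) hEn⟩

/-- **STUB `stub_towerNoetherian` (line `birth` of crux `NoZeno`).** Every stage of the canonical
normalised `ca`-tower of a finitely generated `A ⊆ O` with `Frac A = K` is a noetherian ring
(indeed essentially of finite type over `k`). [cite: Liu2002, Prop. 4.1.27] -/
theorem stub_towerNoetherian (k K : Type) [Field k] [Field K] [Algebra k K]
    (O : ValuationSubring K) (A : Subalgebra k K) (hk : ∀ c : k, algebraMap k K c ∈ O)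
    (hA : A.FG) (hfr : IsFractionRing ↥A K) (hAO : A.toSubring ≤ O.toSubring) (m : ℕ) :
    IsNoetherianRing ↥(tower O A m) := by
  haveI := (tn_tower_invariant O A hk hA hfr hAO m).2.2
  exact Algebra.EssFiniteType.isNoetherianRing k ↥(tower O A m)

end Summit.ResolutionOfSingularities.ResolutionOfSingularities.Theorems.NoZeno.Birth

end
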